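import Literature.AlgebraicGeometry.Frobenioids.PadicKummerSaturatedCofinal
import HarnessLib

/-!
# Frobenioids II, Remark 2.2.1: saturated pull-backs at several levels at once (arithmetic binding)

Mochizuki, *The geometry of Frobenioids II*, Kyushu J. Math. **62** (2008) 401–460, §2, Definition
2.2 (ii) pp. 17–18 and Remark 2.2.1 p. 18 [cite: MochizukiFrdII2008, Rmk 2.2.1 p.18]: "it follows
immediately from the definitions, together with the finiteness of the cohomology modules
`H¹(H, μ_N(A))`, `H²(H, μ_N(A))` …, that given an `A′ ∈ Ob(C)`, … for any `N`, `H` as in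
Definition 2.2, there exists a pull-back morphism `A″ → A′` in `C` such that `A″` is
`(N, H)`-saturated."  [EtTh] Prop 5.2 (i) (proof, PRIMS p. 324) and [EtTh] Rmk 4.3.2 apply this
remark at TWO levels `N ∣ M` over ONE covering object ("the field `J̈_{l·N}`"); the cell's gap row
G-w5d134g4-1 (plan/GAP-LEDGER.md) records the corresponding two-level refinement law `hE₂` of
`Literature.AnabelianGeometry.EtaleTheta.BiKummerSetting.exists_nthRoot_twoLevel_mkOfModelCanonical`.

PROOF-ONLY sequel of `PadicKummerSaturatedPullback.lean` / `PadicKummerSaturatedCofinal.lean`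
(abc-iut-L1-t7 lineage): the ARITHMETIC-BINDING half of that law in the JOINT-EXISTENCE form, with
no persistence/monotonicity law needed.  The proof of `exists_isNHSaturated_ofLocalField` in fact
produces a neighbourhood `V` of `1` in `G_K` such that EVERY finite Galois `L ⊆ K̄` with
`Gal(K̄/L) ⊆ V` gives an `(N, H)`-saturated context; we expose this (§1), intersect finitely many
such neighbourhoods (§2), and read off the two-level statements (§3).

§1 `Def22Context.exists_nhds_one_forall_isNHSaturated_ofLocalField` — for `K` a non-archimedean
local field of characteristic `0`, `H ⊆ G_K` open normal and `N ≥ 1`: there is `V ∈ 𝓝 (1 : G_K)`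
such that for every finite Galois `L ⊆ K̄` with `Gal(K̄/L) ⊆ V` and every `Gal(L/K)`-stable
submonoid `S = O^□_L ∋ μ_N(L)`, the context `ofLocalField L H hH S` is `(N, H)`-saturated
("every sufficiently large finite Galois `L` is `(N, H)`-saturated").

§2 `Def22Context.exists_forall_isNHSaturated_ofLocalField_family` — for a FINITE family
`(Hᵢ, Nᵢ)ᵢ` of open normal subgroups and levels and any finite `L′ ⊆ K̄`: ONE finite Galois
`L ⊇ L′` with `Gal(K̄/L) ≤ Hᵢ` for all `i` (cofinality, as in `PadicKummerSaturatedCofinal`) whose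
contexts are `(Nᵢ, Hᵢ)`-saturated for every `i` and every admissible `S`.

§3 `Def22Context.exists_isNHSaturated_ofLocalField_twoLevel` (two levels `N`, `M`, one `H`; the
divisibility `N ∣ M` of [EtTh] is idle), `Def22Context.exists_saturated_kummerHypotheses_ofLocalField_twoLevel`
(all the standing hypotheses of Definition 2.3 at both levels over one object, the two-level form of
`PadicKummerSaturatedCofinal`'s theorem) and the discharge-shape
`existsSaturatedPullback_twoLevel_ofLocalField` over the same object family as
`existsSaturatedPullback_ofLocalField` ("there is `A″ → A′` with `A″` both `(N, H)`- and
`(M, H)`-saturated").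

No definitions; nothing here concerns [IUTchIII]; classical local Galois cohomology. Universe `0`.
-/

noncomputable section

namespace Literature.AlgebraicGeometry.Frobenioids

namespace PadicKummer

open Field IntermediateField CategoryTheory Topology Filter
open Literature.NumberTheory.GaloisRepresentations
open Literature.NumberTheory.GaloisRepresentations.LocalWeilDatum
open Literature.NumberTheory.GaloisRepresentations.DiscreteGaloisModule

namespace Def22Context

variable {K : Type} [Field K] [ValuativeRel K] [TopologicalSpace K] [IsNonarchimedeanLocalField K]
  [CharZero K]

/-! ### §1 A neighbourhood of `1` all of whose finite Galois fields are `(N, H)`-saturated -/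

/-- **Remark 2.2.1, neighbourhood form** (FrdII p. 18): for `K` a non-archimedean local field of
characteristic `0`, `H ⊆ G_K` open normal and `N ≥ 1`, there is a neighbourhood `V` of `1` in `G_K`
such that for EVERY finite Galois `L ⊆ K̄` with `Gal(K̄/L) ⊆ V` the context `ofLocalField L H hH S`
is `(N, H)`-saturated for every `Gal(L/K)`-stable submonoid `S = O^□_L ⊆ L` containing the `N`-th
roots of unity of `L`.  (`V` = the intersection of: open normal subgroups adapted to representative
`2`-cocycles of the finitely many classes of `H²(H, μ_N(K̄))`, the zero-loci of representative
crossed homomorphisms of the finitely many classes of `H¹(H, μ_N(K̄))` and `H¹(H, ℤ/Nℤ)`, and the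
stabiliser of `μ_N(K̄)` — "the finiteness of the cohomology modules `H¹(H, μ_N(A))`,
`H²(H, μ_N(A))`".) [cite: MochizukiFrdII2008, Rmk 2.2.1 p.18] -/
theorem exists_nhds_one_forall_isNHSaturated_ofLocalField (H : Subgroup (absoluteGaloisGroup K))
    [H.Normal] (hH : IsOpen (H : Set (absoluteGaloisGroup K))) (N : ℕ) [NeZero N] :
    ∃ V ∈ 𝓝 (1 : absoluteGaloisGroup K), ∀ (L : IntermediateField K (AlgebraicClosure K))
      [FiniteDimensional K L] [IsGalois K L],
        (galFixing K L : Set (absoluteGaloisGroup K)) ⊆ V → ∀ S : StableSubmonoid L,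
          (∀ x : L, x ^ N = 1 → x ∈ S.toSubmonoid) → IsNHSaturated (ofLocalField L H hH S) N := by
  classical
  haveI : IsClosed (H : Set (absoluteGaloisGroup K)) := H.isClosed_of_isOpen hH
  -- a closed subgroup of the compact `G_K` is compact (no instance attribute: in-proof only)
  haveI : CompactSpace H := compactSpace_of_isClosed_subgroup
  haveI : Finite (absoluteGaloisGroup K ⧸ H) := Subgroup.quotient_finite_of_isOpen H hH
  haveI : Finite (MuCarrier K N) := finite_muCarrier K N
  -- the two `L`-independent models `μ_N(K̄)|_H` and `ℤ/Nℤ`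
  set T : TopRep ℤ H := ((mu K N).restrict (subgroupIncl H)).toTopRep with hT
  set T₀ : TopRep ℤ H := ((ContinuousRep.trivial (absoluteGaloisGroup K) ℤ (ZMod N)).restrict
    (subgroupIncl H)).toTopRep with hT₀
  -- finiteness of `H¹(H, μ_N)`, `H¹(H, ℤ/N)`, `H²(H, μ_N)` (Remark 2.2.1's input, NSW 7.2.6)
  haveI : Finite (continuousCohomology 1 T) := finite_continuousCohomology_one_restrict K H (mu K N)
  haveI : Finite (continuousCohomology 1 T₀) :=
    finite_continuousCohomology_one_restrict K H
      (ContinuousRep.trivial (absoluteGaloisGroup K) ℤ (ZMod N))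
  haveI : Finite (continuousCohomology 2 T) := by
    obtain ⟨E₀, hfin, _, hE⟩ := exists_galFixing_eq H hH
    subst hE
    haveI := hfin
    exact finite_two_mu K E₀ N
  -- representative cocycles, and for `H²` an adapted open normal subgroup for each
  have h2 : ∀ y : continuousCohomology 2 T, ∃ c : contTwoCocycles T,
      ∃ W : OpenNormalSubgroup (absoluteGaloisGroup K),
        twoCocycleClass T c = y ∧ IsAdapted (mu K N) H W c := fun y => by
    obtain ⟨c, rfl⟩ := twoCocycleClass_surjective T y
    obtain ⟨W, hW⟩ := exists_openNormalSubgroup_adapted (mu K N) H c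
    exact ⟨c, W, rfl, hW⟩
  choose c₂ W₂ hc₂ hW₂ using h2
  choose ψ₁ hψ₁ using oneCocycleClass_surjective T
  choose ψ₀ hψ₀ using oneCocycleClass_surjective T₀
  -- the neighbourhood of `1` in `G_K` to be dominated by `Gal(K̄/L)`
  set S₁ : Set (absoluteGaloisGroup K) :=
    ⋂ y, (((W₂ y : OpenNormalSubgroup (absoluteGaloisGroup K)) : Subgroup (absoluteGaloisGroup K)) :
      Set (absoluteGaloisGroup K)) with hS₁
  set S₂ : Set (absoluteGaloisGroup K) := ⋂ x, Subtype.val '' ((ψ₁ x).1 ⁻¹' {0}) with hS₂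
  set S₃ : Set (absoluteGaloisGroup K) := ⋂ x, Subtype.val '' ((ψ₀ x).1 ⁻¹' {0}) with hS₃
  set S₄ : Set (absoluteGaloisGroup K) := ⋂ a : MuCarrier K N, {g | mu K N g a = a} with hS₄
  set V : Set (absoluteGaloisGroup K) := S₁ ∩ S₂ ∩ S₃ ∩ S₄ with hV
  have hV1 : V ∈ 𝓝 (1 : absoluteGaloisGroup K) := by
    refine inter_mem (inter_mem (inter_mem ?_ ?_) ?_) ?_
    · exact (Filter.iInter_mem).2 fun y => (W₂ y).toOpenSubgroup.isOpen.mem_nhds (one_mem _)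
    · refine (Filter.iInter_mem).2 fun x => IsOpen.mem_nhds ?_ ⟨1, contOneCocycles.apply_one _, rfl⟩
      exact hH.isOpenMap_subtype_val _ ((isOpen_discrete _).preimage (ψ₁ x).1.continuous)
    · refine (Filter.iInter_mem).2 fun x => IsOpen.mem_nhds ?_ ⟨1, contOneCocycles.apply_one _, rfl⟩
      exact hH.isOpenMap_subtype_val _ ((isOpen_discrete _).preimage (ψ₀ x).1.continuous)
    · exact (Filter.iInter_mem).2 fun a => (mu K N).setOf_apply_eq_mem_nhds_one a
  refine ⟨V, hV1, fun L _ _ hLV S hS => ?_⟩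
  -- unpacking membership in `V`
  have hW : ∀ {g : absoluteGaloisGroup K}, g ∈ galFixing K L → ∀ y,
      g ∈ ((W₂ y : OpenNormalSubgroup (absoluteGaloisGroup K)) : Subgroup (absoluteGaloisGroup K)) :=
    fun hg y => Set.mem_iInter.1 (hLV hg).1.1.1 y
  have hψ₁0 : ∀ {σ : H}, (σ : absoluteGaloisGroup K) ∈ galFixing K L → ∀ x, (ψ₁ x).1 σ = 0 := by
    intro σ hσ x
    obtain ⟨σ', hσ', hval⟩ := Set.mem_iInter.1 (hLV hσ).1.1.2 x
    rw [← Subtype.ext hval]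
    exact hσ'
  have hψ₀0 : ∀ {σ : H}, (σ : absoluteGaloisGroup K) ∈ galFixing K L → ∀ x, (ψ₀ x).1 σ = 0 := by
    intro σ hσ x
    obtain ⟨σ', hσ', hval⟩ := Set.mem_iInter.1 (hLV hσ).1.2 x
    rw [← Subtype.ext hval]
    exact hσ'
  have hfix : ∀ {g : absoluteGaloisGroup K}, g ∈ galFixing K L → ∀ a : MuCarrier K N,
      mu K N g a = a := fun hg a => Set.mem_iInter.1 (hLV hg).2 a
  -- `μ_N(K̄) ⊆ L`
  have hμ : ∀ ζ : rootsOfUnity N (AlgebraicClosure K),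
      ((ζ : (AlgebraicClosure K)ˣ) : AlgebraicClosure K) ∈ L := fun ζ => by
    refine mem_of_forall_galFixing_smul_eq L fun σ hσ => ?_
    have h := congrArg (fun v => ((muVal K N v : (AlgebraicClosure K)ˣ) : AlgebraicClosure K))
      (hfix hσ (MuCarrier.ofRootsOfUnity ζ))
    simpa only [muVal_apply, muVal_ofRootsOfUnity, Units.coe_smul] using h
  -- the criteria of `isNHSaturated_ofGalois_of_model`
  refine isNHSaturated_ofGalois_of_model L H hH (GalMonoid S) (MonoidHom.id _) (fun _ _ => rfl)
    (muModelOfSubmonoid L S N hS (NeZero.pos N) hμ) (isMuSaturated_galMonoid L S N hS hμ) ‹_›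
    ?_ ?_ ?_
  · -- (c₁): `c = ψ₁ [c] + (σ ↦ σ v - v)`, both vanishing on `Gal(K̄/L) ∩ H`
    intro c σ hσ
    have h0 : oneCocycleClass T (c - ψ₁ (oneCocycleClass T c)) = 0 := by
      rw [oneCocycleClass_sub, hψ₁, sub_self]
    obtain ⟨v, hv⟩ := (oneCocycleClass_eq_zero_iff T _).mp h0
    have h1 := hv σ
    rw [Submodule.coe_sub, ContinuousMap.sub_apply, hψ₁0 hσ, sub_zero] at h1
    rw [h1]
    change mu K N (σ : absoluteGaloisGroup K) v - v = 0
    rw [hfix hσ, sub_self]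
  · -- (c₂): for the trivial action `c = ψ₀ [c]` on the nose
    intro c σ hσ
    have h0 : oneCocycleClass T₀ (c - ψ₀ (oneCocycleClass T₀ c)) = 0 := by
      rw [oneCocycleClass_sub, hψ₀, sub_self]
    obtain ⟨v, hv⟩ := (oneCocycleClass_eq_zero_iff T₀ _).mp h0
    have h1 := hv σ
    rw [Submodule.coe_sub, ContinuousMap.sub_apply, hψ₀0 hσ, sub_zero] at h1
    rw [h1]
    exact sub_self v
  · -- (c₃): the chosen representative is adapted to `W₂ y ⊇ Gal(K̄/L)`
    intro y
    refine ⟨c₂ y, hc₂ y, fun σ τ k hk => ?_, fun σ τ k hk => ?_⟩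
    · refine (hW₂ y).const (σ * k) τ σ τ ?_ ?_
      · rw [Subgroup.coe_mul, mul_inv_rev, inv_mul_cancel_right]
        exact Subgroup.inv_mem _ (hW hk y)
      · rw [inv_mul_cancel]
        exact Subgroup.one_mem _
    · refine (hW₂ y).const σ (τ * k) σ τ ?_ ?_
      · rw [inv_mul_cancel]
        exact Subgroup.one_mem _
      · rw [Subgroup.coe_mul, mul_inv_rev, inv_mul_cancel_right]
        exact Subgroup.inv_mem _ (hW hk y)

/-! ### §2 One finite Galois field saturated for a finite family of levels and subgroups -/

/-- **Remark 2.2.1 at finitely many `(N, H)` at once, cofinally** (FrdII p. 18; the use made of it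
in [EtTh] Prop 5.2 (i), proof p. 324, "the field `J̈_{l·N}`"): for `K` a non-archimedean local field
of characteristic `0`, a FINITE family of open normal subgroups `Hᵢ ⊆ G_K` and levels `Nᵢ ≥ 1`,
and any finite `L′ ⊆ K̄`, there is ONE finite Galois `L ⊇ L′` inside `K̄` with `Gal(K̄/L) ≤ Hᵢ`
for every `i` such that the context `ofLocalField L Hᵢ _ S` is `(Nᵢ, Hᵢ)`-saturated for every
`i` and every `Gal(L/K)`-stable submonoid `S = O^□_L ∋ μ_{Nᵢ}(L)` (intersect the finitely many
neighbourhoods of `exists_nhds_one_forall_isNHSaturated_ofLocalField` with the `Hᵢ` and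
`Gal(K̄/L′)`, then take a finite Galois `L` with `Gal(K̄/L)` inside, Krull topology).
[cite: MochizukiFrdII2008, Rmk 2.2.1 p.18] -/
theorem exists_forall_isNHSaturated_ofLocalField_family {ι : Type} [Finite ι]
    (L' : IntermediateField K (AlgebraicClosure K)) [FiniteDimensional K L']
    (H : ι → Subgroup (absoluteGaloisGroup K)) [∀ i, (H i).Normal]
    (hH : ∀ i, IsOpen (H i : Set (absoluteGaloisGroup K))) (N : ι → ℕ) (hN : ∀ i, 0 < N i) :
    ∃ L : IntermediateField K (AlgebraicClosure K), ∃ (_ : FiniteDimensional K L)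
      (_ : IsGalois K L), L' ≤ L ∧ (∀ i, galFixing K L ≤ H i) ∧
        ∀ i (S : StableSubmonoid L), (∀ x : L, x ^ N i = 1 → x ∈ S.toSubmonoid) →
          IsNHSaturated (ofLocalField L (H i) (hH i) S) (N i) := by
  haveI : ∀ i, NeZero (N i) := fun i => NeZero.of_pos (hN i)
  choose V hV hsat using fun i =>
    exists_nhds_one_forall_isNHSaturated_ofLocalField (K := K) (H i) (hH i) (N i)
  set W : Set (absoluteGaloisGroup K) := (⋂ i, V i) ∩ (⋂ i, (H i : Set (absoluteGaloisGroup K))) ∩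
    (galFixing K L' : Set (absoluteGaloisGroup K)) with hW
  have hW1 : W ∈ 𝓝 (1 : absoluteGaloisGroup K) := by
    refine inter_mem (inter_mem ?_ ?_) ?_
    · exact (Filter.iInter_mem).2 hV
    · exact (Filter.iInter_mem).2 fun i => (hH i).mem_nhds (one_mem _)
    · exact (isOpen_galFixing K L').mem_nhds (one_mem _)
  -- a finite Galois `L` with `Gal(K̄/L) ⊆ W`
  obtain ⟨L, hLfin, hLgal, hLW⟩ := exists_finiteDimensional_isGalois_galFixing_subset hW1
  haveI := hLfin
  haveI := hLgal
  refine ⟨L, hLfin, hLgal, ?_, fun i => ?_, fun i S hS => ?_⟩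
  · -- `L′ ⊆ L`: `Gal(K̄/L) ⊆ Gal(K̄/L′)` and the Galois correspondence for `K̄/K`
    intro x hx
    exact mem_of_forall_galFixing_smul_eq L fun σ hσ =>
      (mem_galFixing_iff K).mp ((hLW hσ).2) x hx
  · -- `Gal(K̄/L) ≤ Hᵢ`
    intro g hg
    exact Set.mem_iInter.1 (hLW hg).1.2 i
  · -- saturation at `(Nᵢ, Hᵢ)`: `Gal(K̄/L) ⊆ Vᵢ`
    exact hsat i L (fun g hg => Set.mem_iInter.1 (hLW hg).1.1 i) S hS

/-! ### §3 Two levels -/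

/-- **Remark 2.2.1 at two levels `N`, `M` over one field** (FrdII p. 18; [EtTh] Rmk 4.3.2 / Prop 5.2
(i) "the `N`-th root of the `l`-th root": one covering that is saturated at both levels): for `K` a
non-archimedean local field of characteristic `0`, every finite `L′ ⊆ K̄`, open normal `H ⊆ G_K`
and `N, M ≥ 1`, there is a finite Galois `L ⊇ L′` with `Gal(K̄/L) ≤ H` such that `ofLocalField L H
hH S` is `(N, H)`-saturated for every admissible `S ∋ μ_N(L)` AND `(M, H)`-saturated for every
admissible `S ∋ μ_M(L)` (no divisibility `N ∣ M` is needed). [cite: MochizukiFrdII2008, Rmk 2.2.1 p.18] -/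
theorem exists_isNHSaturated_ofLocalField_twoLevel (L' : IntermediateField K (AlgebraicClosure K))
    [FiniteDimensional K L'] (H : Subgroup (absoluteGaloisGroup K)) [H.Normal]
    (hH : IsOpen (H : Set (absoluteGaloisGroup K))) (N M : ℕ) [NeZero N] [NeZero M] :
    ∃ L : IntermediateField K (AlgebraicClosure K), ∃ (_ : FiniteDimensional K L)
      (_ : IsGalois K L), L' ≤ L ∧ galFixing K L ≤ H ∧
        (∀ S : StableSubmonoid L, (∀ x : L, x ^ N = 1 → x ∈ S.toSubmonoid) →
          IsNHSaturated (ofLocalField L H hH S) N) ∧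
        (∀ S : StableSubmonoid L, (∀ x : L, x ^ M = 1 → x ∈ S.toSubmonoid) →
          IsNHSaturated (ofLocalField L H hH S) M) := by
  obtain ⟨L, hLfin, hLgal, hle, hH', hsat⟩ :=
    exists_forall_isNHSaturated_ofLocalField_family (ι := Bool) L' (fun _ => H) (fun _ => hH)
      (fun b => cond b N M) (fun b => by cases b; exacts [NeZero.pos M, NeZero.pos N])
  exact ⟨L, hLfin, hLgal, hle, hH' true, hsat true, hsat false⟩

/-- **Remark 2.2.1 + Definition 2.3 at two levels: all standing hypotheses at once, cofinally**
(FrdII pp. 18–19; the two-level form of `exists_saturated_kummerHypotheses_ofLocalField`): for `K`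
a non-archimedean local field of characteristic `0`, above every finite `L′ ⊆ K̄` and for all
`N, M ≥ 1`, every open normal `H ⊆ G_K` and either choice of `O^□` (Def. 2.2 (iii), `fs`), there is
ONE finite Galois `L″ ⊇ L′` with `Gal(K̄/L″) ≤ H` such that for `A″ = (L″, O^□_{L″})` and for BOTH
levels `n = N, M`: `A″` is `(n, H)`-saturated; every `f ∈ O^□(A″)^H` admits an `n`-th root in
`O^□(A″)` (`Kummer.InvariantsAdmitRoots`); `n`-th roots differ by units
(`Kummer.NthRootsDifferByUnits`); and `F_n(A″) ≅ ℤ/nℤ` — so the Kummer and reciprocity maps of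
Definition 2.3 at both levels are defined on all of `O^□(A″)^H` over the same object.
[cite: MochizukiFrdII2008, Def 2.3 p.19] -/
theorem exists_saturated_kummerHypotheses_ofLocalField_twoLevel
    (L' : IntermediateField K (AlgebraicClosure K)) [FiniteDimensional K L']
    (H : Subgroup (absoluteGaloisGroup K)) [H.Normal]
    (hH : IsOpen (H : Set (absoluteGaloisGroup K))) (N M : ℕ) [NeZero N] [NeZero M] (fs : Prop) :
    ∃ L : IntermediateField K (AlgebraicClosure K), ∃ (_ : FiniteDimensional K L)
      (_ : IsGalois K L), L' ≤ L ∧ galFixing K L ≤ H ∧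
        (IsNHSaturated (ofLocalField L H hH (boxStableSubmonoid K L fs)) N ∧
          Kummer.InvariantsAdmitRoots N (GalMonoid (boxStableSubmonoid K L fs))
            (ofLocalField L H hH (boxStableSubmonoid K L fs)).HA ∧
          Kummer.NthRootsDifferByUnits N (GalMonoid (boxStableSubmonoid K L fs)) ∧
          Nonempty (FN (ofLocalField L H hH (boxStableSubmonoid K L fs)) N ≃+ ZMod N)) ∧
        (IsNHSaturated (ofLocalField L H hH (boxStableSubmonoid K L fs)) M ∧
          Kummer.InvariantsAdmitRoots M (GalMonoid (boxStableSubmonoid K L fs))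
            (ofLocalField L H hH (boxStableSubmonoid K L fs)).HA ∧
          Kummer.NthRootsDifferByUnits M (GalMonoid (boxStableSubmonoid K L fs)) ∧
          Nonempty (FN (ofLocalField L H hH (boxStableSubmonoid K L fs)) M ≃+ ZMod M)) := by
  obtain ⟨L, hfin, hgal, hle, hHL, hsatN, hsatM⟩ :=
    exists_isNHSaturated_ofLocalField_twoLevel L' H hH N M
  haveI := hfin
  haveI := hgal
  have hSN : ∀ x : L, x ^ N = 1 → x ∈ (boxStableSubmonoid K L fs).toSubmonoid := fun x hx =>
    mem_boxStableSubmonoid_of_pow_eq_one K L N fs (NeZero.pos N) hx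
  have hSM : ∀ x : L, x ^ M = 1 → x ∈ (boxStableSubmonoid K L fs).toSubmonoid := fun x hx =>
    mem_boxStableSubmonoid_of_pow_eq_one K L M fs (NeZero.pos M) hx
  have hN := hsatN (boxStableSubmonoid K L fs) hSN
  have hM := hsatM (boxStableSubmonoid K L fs) hSM
  have hμN := coe_rootsOfUnity_mem_of_isMuSaturated L (boxStableSubmonoid K L fs) N hN.muSaturated
  have hμM := coe_rootsOfUnity_mem_of_isMuSaturated L (boxStableSubmonoid K L fs) M hM.muSaturated
  exact ⟨L, hfin, hgal, hle, hHL,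
    ⟨hN, saturatedInvariantsAdmitRoots_ofLocalField_box L N H hH fs hHL hN,
      GalMonoid.nthRootsDifferByUnits (boxStableSubmonoid K L fs) N hSN,
      nonempty_fn_equiv_zmod_ofLocalField L H hH (boxStableSubmonoid K L fs) N hSN hμN hN⟩,
    ⟨hM, saturatedInvariantsAdmitRoots_ofLocalField_box L M H hH fs hHL hM,
      GalMonoid.nthRootsDifferByUnits (boxStableSubmonoid K L fs) M hSM,
      nonempty_fn_equiv_zmod_ofLocalField L H hH (boxStableSubmonoid K L fs) M hSM hμM hM⟩⟩

end Def22Context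

/-! ### The two-level form of the named fact `ExistsSaturatedPullback`, discharged -/

section Discharge

variable (K : Type) [Field K] [ValuativeRel K] [TopologicalSpace K] [IsNonarchimedeanLocalField K]
  [CharZero K]

/-- **Remark 2.2.1 at two levels, DISCHARGED at the arithmetic binding** (FrdII p. 18, as used in
[EtTh] Prop 5.2 (i), proof p. 324): for the family of Definition 2.2 contexts
`(A, H) ↦ Def22Context.ofLocalField L_A H (O^□_{L_A})` of `existsSaturatedPullback_ofLocalField`
(objects: the finite normal `L ⊆ K̄`; `O^□ = O^⊳` or `O^×` according as `fs`; "there is a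
pull-back morphism `A″ → A′`" read on bases as `L′ ⊆ L″`): given `A′`, levels `N, M ≥ 1` and an
open normal `H ⊆ G_K`, there is ONE `A″ → A′` with `A″` both `(N, H)`-saturated and
`(M, H)`-saturated. [cite: MochizukiFrdII2008, Rmk 2.2.1 p.18] -/
theorem existsSaturatedPullback_twoLevel_ofLocalField (fs : Prop)
    (A' : {L : IntermediateField K (AlgebraicClosure K) // FiniteDimensional K L ∧ Normal K L})
    (N M : ℕ) (H : OpenNormalSubgroup (absoluteGaloisGroup K)) (hN : 0 < N) (hM : 0 < M) :
    ∃ A'' : {L : IntermediateField K (AlgebraicClosure K) // FiniteDimensional K L ∧ Normal K L},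
      A'.1 ≤ A''.1 ∧
        (haveI := A''.2.1
         haveI := A''.2.2
         IsNHSaturated (Def22Context.ofLocalField A''.1 (H : Subgroup (absoluteGaloisGroup K))
            H.toOpenSubgroup.isOpen (boxStableSubmonoid K A''.1 fs)) N ∧
          IsNHSaturated (Def22Context.ofLocalField A''.1 (H : Subgroup (absoluteGaloisGroup K))
            H.toOpenSubgroup.isOpen (boxStableSubmonoid K A''.1 fs)) M) := by
  haveI : NeZero N := NeZero.of_pos hN
  haveI : NeZero M := NeZero.of_pos hM
  haveI := A'.2.1
  obtain ⟨L, hfin, hgal, hle, _, hsatN, hsatM⟩ :=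
    Def22Context.exists_isNHSaturated_ofLocalField_twoLevel A'.1
      (H : Subgroup (absoluteGaloisGroup K)) H.toOpenSubgroup.isOpen N M
  haveI := hgal
  exact ⟨⟨L, hfin, inferInstance⟩, hle,
    hsatN _ fun x hx => mem_boxStableSubmonoid_of_pow_eq_one K L N fs hN hx,
    hsatM _ fun x hx => mem_boxStableSubmonoid_of_pow_eq_one K L M fs hM hx⟩

end Discharge

end PadicKummer

end Literature.AlgebraicGeometry.Frobenioids

end
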